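import Summits.AtomisticToContinuum.Crystallization.Theorems.NashClassCertificatesNashHullBridge
import Summits.AtomisticToContinuum.Crystallization.Theorems.HullMinimalityLayeredWindowsTwoShellSites
import Summits.AtomisticToContinuum.Crystallization.Theorems.PhononSlackCertificatesNearFarGlueRHcpBoxShell

/-!
# Crux `HullMinimality.LayeredWindows` (stmt-AtomisticToContinuum-11778), line `registered`:
# NECESSITY of the positional leaf — frame sites and goodness from approximate sites (lead c4, part 2a)

* `exists_frame_sites` — for a box word `s` and spacing `a ∈ [47/50, 1]` there are a linear isometry `F`,
  one of the two patterns `P` and a labelling `lab` of `P` by the eighteen two-shell labels, with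
  `a • F v = layeredPos a s (idealZ a) (lab v)` (ideal sites) and `lab` onto the labels (part 1's frame
  identity and bookkeeping);
* `good_of_sites` — abstract assembly: approximate sites near the particles give `IsTwoShellGood`;
* `isTwoShellGood_of_window` — a particle of a `1/3`-separated configuration lying `2` inside an
  `(R, 1/200)`-window (two-way `1/200`-match with a rigid image of a box template) is two-shell good
  (`IsTwoShellGood (1/20) (47/50) 1`): its eighteen neighbours sit within `1/200` of the actual sites, which
  are within `37a/1000` of the ideal ones (vertical relaxation of the box), total `< a/20`; the `3a/2`-
  neighbourhood is exhausted by `site_class_two`;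
* `exists_site_norm_le_one` — every box template has a site within `1` of any prescribed centre height… of
  the origin (a layer within `17a/40` of height `0`, a lattice point of it within `2a/3` horizontally);
* `twoShellGoodWindows_freq_of_layeredWindows` — hence `HullMinimality.LayeredWindows` implies, along every
  Lennard-Jones ground-state sequence and for every radius `ρ`, FREQUENTLY in `N`, an all-two-shell-good
  `ρ`-ball: the frequently-form of stub S1 of the line is NECESSARY for the crux (and, with
  `layeredWindows_of_goodWindows_freq`, equivalent to it modulo `NashNearField`).
-/

noncomputable section

open scoped BigOperators Classical
open Filter Topology

namespace Summit.AtomisticToContinuum.Crystallization.Theorems.LayeredWindowsLocal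

open Summit.AtomisticToContinuum.Crystallization.Theses
open Summit.AtomisticToContinuum.Crystallization.Theorems.PrestressSplitKorn
open Literature.MathematicalPhysics.StatisticalMechanics Literature.Geometry.DiscreteGeometry
open Summit.AtomisticToContinuum.Crystallization.Theorems.ChargedEnergyGapNegative (E3)

/-! ## Small facts -/

/-- `‖c • e₃‖ = |c|`. -/
theorem norm_smul_layerNormal_one (c : ℝ) : ‖c • (layerNormal 1 : E3)‖ = |c| := by
  have h : ‖c • (layerNormal 1 : E3)‖ ^ 2 = c ^ 2 := by
    rw [PrestressSplitKorn.norm_sq_fin3]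
    simp [layerNormal]
  have h0 : 0 ≤ ‖c • (layerNormal 1 : E3)‖ := norm_nonneg _
  nlinarith [sq_abs c, abs_nonneg c, sq_nonneg (‖c • (layerNormal 1 : E3)‖ - |c|),
    sq_nonneg (‖c • (layerNormal 1 : E3)‖ + |c|)]

section Template

variable {a : ℝ} {s : ℤ → ℤ} {z : ℤ → ℝ}

/-- **Actual versus ideal site.** In a normalised box template the site of a label of layer `-1, 0, 1`
is within `37a/1000` of the ideal site (same label, heights `idealZ a`): the two differ by the vertical
relaxation `z (±1) ∓ √(2/3)·a`, and `|h - √(2/3)a| ≤ 0.037a` for `h ∈ [39a/50, 17a/20]`. -/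
theorem dist_site_ideal_le (hbox : InBox a z) (hz0 : z 0 = 0) {q : ℤ × ℤ × ℤ}
    (hq : -1 ≤ q.1 ∧ q.1 ≤ 1) :
    dist (layeredPos a s z q) (layeredPos a s (idealZ a) q) ≤ 37 / 1000 * a := by
  have ha := hbox.a_pos
  have hdiff : layeredPos a s z q - layeredPos a s (idealZ a) q = (z q.1 - idealZ a q.1) • layerNormal 1 := by
    simp only [layeredPos]
    module
  rw [dist_eq_norm, hdiff, norm_smul_layerNormal_one]
  obtain ⟨hb1, hb2⟩ := PhononSlackCertificatesNearFarGlueR.sqrt_two_thirds_bounds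
  obtain ⟨m, i, j⟩ := q
  simp only at hq ⊢
  obtain ⟨hq1, hq2⟩ := hq
  interval_cases m
  · have h := hbox.z_neg_one hz0
    simp only [idealZ, Int.reduceNeg, Int.cast_neg, Int.cast_one]
    rw [abs_le]
    constructor <;> nlinarith [h.1, h.2]
  · simp [hz0, idealZ]; positivity
  · have h := hbox.z_one hz0
    simp only [idealZ, Int.cast_one, one_mul]
    rw [abs_le]
    constructor <;> nlinarith [h.1, h.2]

/-- The ideal site of label `(m, i, j)` written out. -/
theorem layeredPos_idealZ_eq (a : ℝ) (s : ℤ → ℤ) (m i j : ℤ) :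
    layeredPos a s (idealZ a) (m, i, j) =
      (i : ℝ) • triangularVec₁ a + (j : ℝ) • triangularVec₂ a + ((haggLabel s m : ℤ) : ℝ) • barlowOffset a +
        ((m : ℝ) * (Real.sqrt (2 / 3) * a)) • layerNormal 1 := by
  simp [layeredPos, idealZ]

/-- Labels of the layers `-1, 0, 1` of a normalised word: `haggLabel s m = (s 0)·m` when the letters below
and above agree (`s (-1) = s 0`), and `= (s 0)·m²` when they differ. -/
theorem haggLabel_small (s : ℤ → ℤ) {m : ℤ} (hm : -1 ≤ m ∧ m ≤ 1) :
    (s (-1) = s 0 → haggLabel s m = s 0 * m) ∧ (s (-1) = -(s 0) → haggLabel s m = s 0 * m ^ 2) := by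
  obtain ⟨h1, h2⟩ := hm
  interval_cases m
  · simp only [Int.reduceNeg, haggLabel_neg_one, mul_neg, mul_one, even_two, Even.neg_pow, one_pow]
    constructor <;> intro h <;> omega
  · simp [haggLabel_zero]
  · simp [haggLabel_one]

/-- **The frame and the labelled sites of a box word.** For a Hägg word `s` and `a ∈ [47/50, 1]` there are
a linear isometry `F`, a pattern `P` (fcc if `s (-1) = s 0`, hcp otherwise) and a labelling `lab` with:
`a • F v` is the IDEAL site of label `lab v` for every `v ∈ P`, the labels have layer `-1, 0, 1`, and every
one of the eighteen two-shell labels of the origin is attained. -/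
theorem exists_frame_sites (hs : IsHaggSeq s) (ha47 : 47 / 50 ≤ a) (ha1 : a ≤ 1) :
    ∃ (F : E3 →ₗᵢ[ℝ] E3) (P : Finset E3) (lab : E3 → ℤ × ℤ × ℤ),
      (P = fccTwoShellPattern ∨ P = hcpTwoShellPattern) ∧
      (∀ v ∈ P, a • F v = layeredPos a s (idealZ a) (lab v)) ∧
      (∀ v ∈ P, -1 ≤ (lab v).1 ∧ (lab v).1 ≤ 1) ∧
      (∀ q ∈ hexLabels ∪ upLabels (s 0) ∪ downLabels (s (-1)) ∪
          ({((1 : ℤ), (1 : ℤ), (-1 : ℤ)), (1, -1, 1), (1, -(s 0), -(s 0))} : Finset (ℤ × ℤ × ℤ)) ∪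
          ({((-1 : ℤ), (1 : ℤ), (-1 : ℤ)), (-1, -1, 1), (-1, s (-1), s (-1))} : Finset (ℤ × ℤ × ℤ)),
        ∃ v ∈ P, lab v = q) := by
  have ha : 0 < a := by linarith
  have hinj : Function.Injective (layeredPos a s (idealZ a)) :=
    layeredPos_injective_of_inBox (inBox_idealZ ha47 ha1)
  obtain ⟨σ, hσdef⟩ : ∃ σ : ℤ, s 0 = σ := ⟨_, rfl⟩
  have hσ : σ = 1 ∨ σ = -1 := hσdef ▸ hs 0
  have hτ : (σ : ℝ) = 1 ∨ (σ : ℝ) = -1 := by rcases hσ with h | h <;> simp [h]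
  have hcase : s (-1) = σ ∨ s (-1) = -σ := by
    rcases hs (-1) with h | h <;> rcases hσ with h' | h' <;> omega
  rcases hcase with e1 | e1
  · -- letters agree: the fcc pattern
    have hL : ∀ {m : ℤ}, -1 ≤ m ∧ m ≤ 1 → haggLabel s m = σ * m := fun hm =>
      hσdef ▸ (haggLabel_small s hm).1 (by rw [e1, hσdef])
    have key : ∀ v : E3, ∃ q : ℤ × ℤ × ℤ, v ∈ fccTwoShellPattern →
        (-1 ≤ q.1 ∧ q.1 ≤ 1) ∧
          a • closePackingFrame (σ : ℝ) hτ v = layeredPos a s (idealZ a) q := by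
      intro v
      by_cases hv : v ∈ fccTwoShellPattern
      · have hv' := hv
        rw [fccTwoShellPattern, scaledPattern, Finset.mem_image] at hv'
        obtain ⟨t, ht, rfl⟩ := hv'
        obtain ⟨m, hm, i, -, j, -, hS, hI, hJ, -⟩ := fcc_sites_bookkeeping hσ t ht
        have hm' : -1 ≤ m ∧ m ≤ 1 := Finset.mem_Icc.1 hm
        refine ⟨(m, i, j), fun _ => ⟨hm', ?_⟩⟩
        rw [layeredPos_idealZ_eq, hL hm']
        have hS' : ((t 0 : ℝ) + t 1 + t 2) = 2 * m := by exact_mod_cast hS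
        have hI' : 3 * (i : ℝ) + σ * m = σ * (3 * (t 1 : ℝ) - ((t 0 : ℝ) + t 1 + t 2)) := by exact_mod_cast hI
        have hJ' : 3 * (j : ℝ) + σ * m = σ * (3 * (t 2 : ℝ) - ((t 0 : ℝ) + t 1 + t 2)) := by exact_mod_cast hJ
        refine frame_identity hτ a _ 1 sqrt_two_inv_mul_sqrt_two t m i j ((σ * m : ℤ) : ℝ) ?_ ?_ ?_
        · linarith
        · push_cast; linarith
        · push_cast; linarith
      · exact ⟨0, fun h => absurd h hv⟩
    choose lab hlab using key
    refine ⟨closePackingFrame (σ : ℝ) hτ, fccTwoShellPattern, lab, Or.inl rfl,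
      fun v hv => (hlab v hv).2, fun v hv => (hlab v hv).1, ?_⟩
    intro q hq
    obtain ⟨m, i, j⟩ := q
    rw [hσdef, e1] at hq
    obtain ⟨t, ht, hq1, hS, hI, hJ⟩ := fcc_labels_bookkeeping hσ _ hq
    simp only at hS hI hJ hq1
    set v : E3 := (Real.sqrt ((2 : ℕ) : ℝ))⁻¹ • intVec t with hvdef
    have hv : v ∈ fccTwoShellPattern := by
      rw [fccTwoShellPattern, scaledPattern]
      exact Finset.mem_image_of_mem _ ht
    refine ⟨v, hv, hinj ?_⟩
    rw [← (hlab v hv).2]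
    rw [layeredPos_idealZ_eq, hL hq1]
    have hS' : ((t 0 : ℝ) + t 1 + t 2) = 2 * m := by exact_mod_cast hS
    have hI' : 3 * (i : ℝ) + σ * m = σ * (3 * (t 1 : ℝ) - ((t 0 : ℝ) + t 1 + t 2)) := by exact_mod_cast hI
    have hJ' : 3 * (j : ℝ) + σ * m = σ * (3 * (t 2 : ℝ) - ((t 0 : ℝ) + t 1 + t 2)) := by exact_mod_cast hJ
    refine frame_identity hτ a _ 1 sqrt_two_inv_mul_sqrt_two t m i j ((σ * m : ℤ) : ℝ) ?_ ?_ ?_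
    · linarith
    · push_cast; linarith
    · push_cast; linarith
  · -- letters differ: the hcp pattern
    have hL : ∀ {m : ℤ}, -1 ≤ m ∧ m ≤ 1 → haggLabel s m = σ * m ^ 2 := fun hm =>
      hσdef ▸ (haggLabel_small s hm).2 (by rw [e1, hσdef])
    have key : ∀ v : E3, ∃ q : ℤ × ℤ × ℤ, v ∈ hcpTwoShellPattern →
        (-1 ≤ q.1 ∧ q.1 ≤ 1) ∧
          a • closePackingFrame (σ : ℝ) hτ v = layeredPos a s (idealZ a) q := by
      intro v
      by_cases hv : v ∈ hcpTwoShellPattern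
      · have hv' := hv
        rw [hcpTwoShellPattern, scaledPattern, Finset.mem_image] at hv'
        obtain ⟨t, ht, rfl⟩ := hv'
        obtain ⟨m, hm, i, -, j, -, hS, hI, hJ, -⟩ := hcp_sites_bookkeeping hσ t ht
        have hm' : -1 ≤ m ∧ m ≤ 1 := Finset.mem_Icc.1 hm
        refine ⟨(m, i, j), fun _ => ⟨hm', ?_⟩⟩
        rw [layeredPos_idealZ_eq, hL hm']
        have hS' : ((t 0 : ℝ) + t 1 + t 2) = 6 * m := by exact_mod_cast hS
        have hI' : 9 * (i : ℝ) + 3 * (σ * (m : ℝ) ^ 2) = σ * (3 * (t 1 : ℝ) - ((t 0 : ℝ) + t 1 + t 2)) := by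
          exact_mod_cast hI
        have hJ' : 9 * (j : ℝ) + 3 * (σ * (m : ℝ) ^ 2) = σ * (3 * (t 2 : ℝ) - ((t 0 : ℝ) + t 1 + t 2)) := by
          exact_mod_cast hJ
        refine frame_identity hτ a _ (1 / 3) sqrt_eighteen_inv_mul_sqrt_two t m i j ((σ * m ^ 2 : ℤ) : ℝ)
          ?_ ?_ ?_
        · linarith
        · push_cast; linarith
        · push_cast; linarith
      · exact ⟨0, fun h => absurd h hv⟩
    choose lab hlab using key
    refine ⟨closePackingFrame (σ : ℝ) hτ, hcpTwoShellPattern, lab, Or.inr rfl,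
      fun v hv => (hlab v hv).2, fun v hv => (hlab v hv).1, ?_⟩
    intro q hq
    obtain ⟨m, i, j⟩ := q
    rw [hσdef, e1] at hq
    obtain ⟨t, ht, hq1, hS, hI, hJ⟩ := hcp_labels_bookkeeping hσ _ hq
    simp only at hS hI hJ hq1
    set v : E3 := (Real.sqrt ((18 : ℕ) : ℝ))⁻¹ • intVec t with hvdef
    have hv : v ∈ hcpTwoShellPattern := by
      rw [hcpTwoShellPattern, scaledPattern]
      exact Finset.mem_image_of_mem _ ht
    refine ⟨v, hv, hinj ?_⟩
    rw [← (hlab v hv).2]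
    rw [layeredPos_idealZ_eq, hL hq1]
    have hS' : ((t 0 : ℝ) + t 1 + t 2) = 6 * m := by exact_mod_cast hS
    have hI' : 9 * (i : ℝ) + 3 * (σ * (m : ℝ) ^ 2) = σ * (3 * (t 1 : ℝ) - ((t 0 : ℝ) + t 1 + t 2)) := by
      exact_mod_cast hI
    have hJ' : 9 * (j : ℝ) + 3 * (σ * (m : ℝ) ^ 2) = σ * (3 * (t 2 : ℝ) - ((t 0 : ℝ) + t 1 + t 2)) := by
      exact_mod_cast hJ
    refine frame_identity hτ a _ (1 / 3) sqrt_eighteen_inv_mul_sqrt_two t m i j ((σ * m ^ 2 : ℤ) : ℝ)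
      ?_ ?_ ?_
    · linarith
    · push_cast; linarith
    · push_cast; linarith

end Template

/-! ## Abstract assembly: approximate sites give goodness -/

/-- **Goodness from approximate sites.** Let `x` be `1/3`-separated, `a ∈ [47/50, 1]`, `F` a linear
isometry, `P` one of the two patterns, and suppose points `site v` (`v ∈ P`) and a centre `c₀` satisfy:
every site has a particle within `1/200` (after the translation `t`), every site is within `37a/1000` of
`c₀ + a • F v`, the particle `j` is within `1/200` of `c₀`, and every other particle within `3a/2` of `x j`
is within `1/200` of some site. Then `j` is `1/20`-good (two-shell) at scale `a` with the frame `F`. -/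
theorem good_of_sites {N : ℕ} {x : Fin N → E3}
    (hsep : ∀ i j : Fin N, i ≠ j → (1 / 3 : ℝ) ≤ dist (x i) (x j))
    {a : ℝ} (ha47 : 47 / 50 ≤ a) (ha1 : a ≤ 1) (F : E3 →ₗᵢ[ℝ] E3) {P : Finset E3}
    (hP : P = fccTwoShellPattern ∨ P = hcpTwoShellPattern) (site : E3 → E3) (t c₀ : E3) {j : Fin N}
    (hS1 : ∀ v ∈ P, ∃ i : Fin N, dist (x i + t) (site v) ≤ 1 / 200)
    (hS2 : ∀ v ∈ P, dist (site v) (c₀ + a • F v) ≤ 37 / 1000 * a)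
    (hS3 : dist (x j + t) c₀ ≤ 1 / 200)
    (hS4 : ∀ j' : Fin N, j' ≠ j → dist (x j') (x j) ≤ 3 / 2 * a →
      ∃ v ∈ P, dist (x j' + t) (site v) ≤ 1 / 200) :
    IsTwoShellGood (1 / 20) (47 / 50) 1 x j := by
  classical
  have ha : 0 < a := by linarith
  -- the assignment
  have hf0 : ∀ v : E3, ∃ i : Fin N, v ∈ P → dist (x i + t) (site v) ≤ 1 / 200 := by
    intro v
    by_cases hv : v ∈ P
    · obtain ⟨i, hi⟩ := hS1 v hv
      exact ⟨i, fun _ => hi⟩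
    · exact ⟨j, fun h => absurd h hv⟩
  choose f hf using hf0
  -- norms of pattern vectors and separation of the pattern
  have hnorm : ∀ v ∈ P, 1 ≤ ‖v‖ := by
    intro v hv
    have h2 : (1 : ℝ) ≤ Real.sqrt 2 := Real.one_le_sqrt.mpr (by norm_num)
    rcases hP with rfl | rfl
    · rcases norm_of_mem_fccTwoShellPattern hv with h | h
      · rw [h]
      · rw [h]; exact h2
    · rcases norm_of_mem_hcpTwoShellPattern hv with h | h
      · rw [h]
      · rw [h]; exact h2
  have hpsep : ∀ v ∈ P, ∀ v' ∈ P, v ≠ v' → 1 ≤ dist v v' := by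
    intro v hv v' hv' hne
    rcases hP with rfl | rfl
    · exact one_le_dist_of_mem_fccTwoShellPattern hv hv' hne
    · exact one_le_dist_of_mem_hcpTwoShellPattern hv hv' hne
  -- two particles within `1/200` of one point coincide
  have hsame : ∀ (i i' : Fin N) (p : E3), dist (x i + t) p ≤ 1 / 200 → dist (x i' + t) p ≤ 1 / 200 → i = i' := by
    intro i i' p hi hi'
    by_contra hne
    have h1 := hsep i i' hne
    have h2 : dist (x i) (x i') ≤ 1 / 200 + 1 / 200 := by
      calc dist (x i) (x i') = dist (x i + t) (x i' + t) := by rw [dist_add_right]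
        _ ≤ dist (x i + t) p + dist (x i' + t) p := dist_triangle_right _ _ _
        _ ≤ 1 / 200 + 1 / 200 := add_le_add hi hi'
    linarith
  refine ⟨a, ha47, ha1, F, P, f, hP, ?_, ?_, ?_⟩
  · -- closeness and `f v ≠ j`
    intro v hv
    have hfv := hf v hv
    have hsv := hS2 v hv
    constructor
    · -- `f v ≠ j`: the site is far from `c₀`
      intro heq
      have hFv : ‖a • F v‖ = a * ‖v‖ := by rw [norm_smul, LinearIsometry.norm_map, Real.norm_of_nonneg ha.le]
      have h1 : a ≤ ‖a • F v‖ := by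
        rw [hFv]; nlinarith [hnorm v hv]
      have h2 : ‖a • F v‖ ≤ dist (x j + t) (site v) + dist (site v) (c₀ + a • F v) + dist (x j + t) c₀ := by
        have e : a • F v = (c₀ + a • F v) - c₀ := by abel
        calc ‖a • F v‖ = dist (c₀ + a • F v) c₀ := by rw [dist_eq_norm, add_sub_cancel_left]
          _ ≤ dist (c₀ + a • F v) (x j + t) + dist (x j + t) c₀ := dist_triangle _ _ _
          _ ≤ (dist (x j + t) (site v) + dist (site v) (c₀ + a • F v)) + dist (x j + t) c₀ := by
              gcongr; rw [dist_comm]; exact dist_triangle _ _ _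
      rw [heq] at hfv
      linarith
    · -- closeness `≤ a/20`
      calc dist (x (f v)) (x j + a • F v)
          = dist (x (f v) + t) (x j + t + a • F v) := by
              rw [show x j + t + a • F v = (x j + a • F v) + t by abel, dist_add_right]
        _ ≤ dist (x (f v) + t) (site v) + dist (site v) (c₀ + a • F v) + dist (c₀ + a • F v) (x j + t + a • F v) :=
              dist_triangle4 _ _ _ _
        _ = dist (x (f v) + t) (site v) + dist (site v) (c₀ + a • F v) + dist c₀ (x j + t) := by
              rw [dist_add_right]
        _ ≤ 1 / 200 + 37 / 1000 * a + 1 / 200 := by rw [dist_comm c₀]; gcongr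
        _ ≤ 1 / 20 * a := by linarith
  · -- injectivity on the pattern
    intro v hv v' hv' hvv'
    by_contra hne
    have hd : 1 ≤ dist v v' := hpsep v hv v' hv' hne
    have hFd : dist (a • F v) (a • F v') = a * dist v v' := by
      rw [dist_eq_norm, ← smul_sub, norm_smul, ← map_sub, LinearIsometry.norm_map, Real.norm_of_nonneg ha.le,
        ← dist_eq_norm]
    have h1 : a ≤ dist (a • F v) (a • F v') := by rw [hFd]; nlinarith
    have h2 : dist (a • F v) (a • F v') ≤ dist (site v) (c₀ + a • F v) + dist (site v') (c₀ + a • F v') +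
        (dist (x (f v) + t) (site v) + dist (x (f v') + t) (site v')) := by
      have e1 : dist (a • F v) (a • F v') = dist (c₀ + a • F v) (c₀ + a • F v') := by rw [dist_add_left]
      rw [e1]
      calc dist (c₀ + a • F v) (c₀ + a • F v')
          ≤ dist (c₀ + a • F v) (site v) + dist (site v) (site v') + dist (site v') (c₀ + a • F v') :=
            dist_triangle4 _ _ _ _
        _ ≤ dist (c₀ + a • F v) (site v) + (dist (site v) (x (f v) + t) + dist (x (f v) + t) (site v')) +
              dist (site v') (c₀ + a • F v') := by gcongr; exact dist_triangle _ _ _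
        _ = dist (site v) (c₀ + a • F v) + dist (site v') (c₀ + a • F v') +
              (dist (x (f v) + t) (site v) + dist (x (f v') + t) (site v')) := by
            rw [dist_comm (c₀ + a • F v), dist_comm (site v) (x (f v) + t), hvv']; ring
    have := hS2 v hv
    have := hS2 v' hv'
    have := hf v hv
    have := hf v' hv'
    linarith
  · -- two-way: every other particle within `3a/2` is assigned
    intro j' hj' hd
    obtain ⟨v, hv, hv'⟩ := hS4 j' hj' hd
    exact ⟨v, hv, hsame _ _ _ (hf v hv) hv'⟩


/-- Landing anchor of this file (registered sub-goal of crux stmt-AtomisticToContinuum-11778; re-exports `haggLabel_small`,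
the letter bookkeeping behind `exists_frame_sites`). -/
theorem necessitySites_anchor : ∀ (s : ℤ → ℤ) (m : ℤ), (-1 ≤ m ∧ m ≤ 1) → (s (-1) = s 0 → Literature.MathematicalPhysics.StatisticalMechanics.haggLabel s m = s 0 * m) ∧ (s (-1) = -(s 0) → Literature.MathematicalPhysics.StatisticalMechanics.haggLabel s m = s 0 * m ^ 2) :=
  fun s _ hm => haggLabel_small s hm

end Summit.AtomisticToContinuum.Crystallization.Theorems.LayeredWindowsLocal

end
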